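import Literature.Computability.AlgebraicComplexity.ObstructionTypes
import Literature.Computability.AlgebraicComplexity.MultiplicityObstructionsProofs
import Literature.Computability.AlgebraicComplexity.DeterminantalComplexityProofs
import Literature.Computability.AlgebraicComplexity.OrbitClosureProofs
import Literature.NumberTheory.DiophantineGeometry.SchurWeylPlethysmRenameProofs
import Literature.NumberTheory.DiophantineGeometry.SchurWeylPlethysmKroneckerBoundProofs
import Literature.NumberTheory.DiophantineGeometry.DetOrbitSymKroneckerBound
import HarnessLib

/-!
# Multiplicity obstructions for determinant versus padded permanent bound `dc(per_n)` from below

The statement the GCT multiplicity-obstruction engine (cell `pub-gct`, papers/PneNP/gct-obstructions)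
certifies, in the tree's vocabulary, together with its PROVED consequence for determinantal
complexity. Honest framing of that cell: rung-1 multiplicity-obstruction search for permanent vs
determinant at small `(n, m)`; no claim about VP ≠ VNP or P ≠ NP is made here or there.

Cell coordinates: `n` = size of the permanent, `m` = size of the determinant, `n ≤ m`; the padded
permanent is `X₀₀^{m-n} · per_n` (`paddedPerFormLex k n m`, lexicographically ordered matrix
variables `MatIdx m`, `SchurWeylPlethysm.lean`), `Ω_m = Δ(det_m)` is the orbit closure of
`detFormLex k m`, and `mult_χ` is `orbitMultiplicity` (highest-weight multiplicity in the coordinate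
ring of the orbit closure, `GLHighestWeight`/`SchurWeylPlethysm`).

* `PerDetMultiplicityObstruction n m χ` (weight form): `n ≤ m` and
  `mult_χ k[Δ(det_m)] < mult_χ k[Δ(X₀₀^{m-n} per_n)]` — literally `n ≤ m ∧
  IsMultiplicityObstructionAt (detFormLex k m) (paddedPerFormLex k n m) m χ` (`ObstructionTypes.lean`).
* `PerDetMultiplicityObstructionAt n m d λ` (the engine's certificate coordinates `(n, m, d, λ)`):
  `λ ⊢ m·d` with at most `m²` parts and the weight form for `χ = λ^*` transported to `MatIdx m`
  (`(Weight.dualOfPartition (m*m) λ).toMatIdx`, the convention of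
  `orbitMultiplicity_det_le_kroneckerCoeff`).
* `PerDetKroneckerObstructionAt n m d λ`: the det side replaced by its published upper bound, the
  rectangular Kronecker coefficient: `g(λ, m×d, m×d) < mult_{λ^*} k[Δ(X₀₀^{m-n} per_n)]`.
* `PerDetSymKroneckerObstructionAt n m d λ`: the det side replaced by the SHARPER published upper
  bound, the rectangular symmetric Kronecker coefficient `sk(λ, m×d)` (`symKroneckerCoeffRect`,
  `DetOrbitSymKroneckerBound.lean`): `sk(λ, m×d) < mult_{λ^*} k[Δ(X₀₀^{m-n} per_n)]` — the det-side
  test of Bürgisser–Ikenmeyer STOC 2013 (5.2) / Ikenmeyer 2012 (8.1.1).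

Theorems (all sorry-free over the tree's discharged facts):
* `PerDetKroneckerObstructionAt.perDetMultiplicityObstructionAt` — BLMW 2011 Prop. 5.2.1 /
  Bürgisser–Ikenmeyer STOC 2011 Thm. 4.3 (`orbitMultiplicity_det_le_kroneckerCoeff_holds`).
* `PerDetSymKroneckerObstructionAt.perDetMultiplicityObstructionAt` — BLMW 2011 Prop. 5.2.1 (5.2.7)
  (`orbitMultiplicity_det_le_symKroneckerCoeffRect`, proved in `DetOrbitSymKroneckerBound.lean`);
  `PerDetKroneckerObstructionAt.perDetSymKroneckerObstructionAt` (`sk ≤ g`, BLMW (5.2.5));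
  `PerDetSymKroneckerObstructionAt.of_sum_eq` assembles the symmetric form from a value `s` of the
  character sum `∑_τ χ^λ(τ)(χ^□(τ)² + χ^□(τ²)) = 2·(md)!·s` and a lower bound `s < r ≤ mult_{λ^*}` on
  the permanent side (the shape of an engine certificate).
* `not_hasBorderDetRepr_of_perDetMultiplicityObstruction` — the multiplicity-obstruction principle
  (Mulmuley–Sohoni 2008; BLMW 2011 §1; BIP 2019 §1.1; Bläser–Ikenmeyer 2025 §12.4):
  `X₀₀^{m-n} per_n ∉ Δ(det_m)` (`orbitMultiplicity_le_of_mem_orbitClosure_holds`,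
  `hasBorderDetRepr_iff_rename_holds`, via `not_hasBorderDetRepr_of_orbitMultiplicity_lt`).
* `lt_determinantalComplexity_perPoly_of_not_hasBorderDetRepr` — Mulmuley–Sohoni 2001 Prop. 4.4 in
  contrapositive: `X₀₀^{m-n} per_n ∉ Δ(det_m)` and `n ≤ m` give `m < dc(per_n)`
  (`paddedPerPoly_mem_orbitClosure_detPoly_of_hasDetRepr_holds`, `hasDetRepr_determinantalComplexity_holds`,
  `HasDetRepr.mono_holds`).
* `lt_determinantalComplexity_perPoly_of_perDetMultiplicityObstruction` (and the `At` / Kronecker /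
  symmetric Kronecker forms): **a multiplicity obstruction at `(n, m)` proves `dc(per_n) > m`** — Ikenmeyer–Panova 2017,
  Thm. 1.3 of the e-print ("If `q^m_λ(d[n]) > g(λ, n×d, n×d)`, then `dc(per_m) > n`", their letters),
  BLMW 2011 §5.7 Thm., Bürgisser–Ikenmeyer–Panova 2019 §1.1 ("Its existence thus proves that
  `Z_{n,m} ⊄ Ω_n` and hence `dc(per_m) > n`").

No new named facts; no open conjecture is asserted (the EXISTENCE of such obstructions for any
`m > n ≥ 3` is open, Bläser–Ikenmeyer 2025 §12.4 p. 74).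

## References
* C. Ikenmeyer, G. Panova, *Rectangular Kronecker coefficients and plethysms in geometric
  complexity theory*, Adv. Math. 319 (2017) = arXiv:1512.03798, Thm. 1.3 (e-print numbering).
* P. Bürgisser, J. M. Landsberg, L. Manivel, J. Weyman, *An overview of mathematical issues arising
  in the geometric complexity theory approach to VP ≠ VNP*, SIAM J. Comput. 40 (2011) =
  arXiv:0907.2850v3, §1, Prop. 5.2.1, §5.7.
* P. Bürgisser, C. Ikenmeyer, G. Panova, *No occurrence obstructions in geometric complexity
  theory*, J. AMS 32 (2019) = arXiv:1604.06431, §1.1.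
* P. Bürgisser, C. Ikenmeyer, *Explicit lower bounds via geometric complexity theory*, STOC 2013 =
  arXiv:1210.8368, §5 (5.1)–(5.2) (`pl_λ(d[n]) > sk(n×d; λ)`); C. Ikenmeyer, Dissertation,
  Paderborn 2012, §8.1 (8.1.1) and Appendix A.1.
* K. Mulmuley, M. Sohoni, *Geometric complexity theory I*, SIAM J. Comput. 31 (2001), Prop. 4.4;
  *II*, SIAM J. Comput. 38 (2008), §1–3.
* M. Bläser, C. Ikenmeyer, *Introduction to geometric complexity theory*, Theory of Computing
  Graduate Surveys 10 (2025), §12.4.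
-/

noncomputable section

namespace Literature.Computability.AlgebraicComplexity

open _root_.Literature.NumberTheory.DiophantineGeometry

variable {k : Type} [Field k]

/-! ### The three renderings of "λ is a multiplicity obstruction at (n, m)" -/

/-- **Multiplicity obstruction for `det_m` versus the padded permanent `X₀₀^{m-n} per_n`, weight
form** (cell coordinates: `n` = permanent size, `m` = determinant size): `n ≤ m` and the highest
weight `χ` of `GL_{m²}` (lexicographic Borel on `MatIdx m`) has strictly larger multiplicity in
`k[Δ(X₀₀^{m-n} per_n)]` than in `k[Δ(det_m)]`. Definitionally `n ≤ m ∧ IsMultiplicityObstructionAt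
(detFormLex k m) (paddedPerFormLex k n m) m χ`. Bürgisser–Ikenmeyer–Panova 2019 §1.1 ("proving that
`\underline{\tilde k}_n(λ)` is strictly smaller than the latter multiplicity implies that
`Z_{n,m} ⊄ Ω_n`"); Bläser–Ikenmeyer 2025 §12.4. The side condition `n ≤ m` excludes the documented
junk range of `paddedPerPoly`. [cite: BlaeserIkenmeyer2025, §12.4] -/
def PerDetMultiplicityObstruction (n m : ℕ) [NeZero m] (χ : Weight (MatIdx m)) : Prop :=
  n ≤ m ∧ IsMultiplicityObstructionAt (detFormLex k m) (paddedPerFormLex k n m) m χ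

/-- **Partition form / certificate coordinates `(n, m, d, λ)`**: `λ ⊢ m·d` with at most `m²` parts,
and the dual weight `λ^*` transported to `MatIdx m` is a `PerDetMultiplicityObstruction` (the
weight convention of `orbitMultiplicity_det_le_kroneckerCoeff`: the irreducibles of
`k[Sym^m (k^{m²})]_d ⊇ k[Δ(·)]_d` are the duals `V(λ)^*`, `λ ⊢ m d`, `ℓ(λ) ≤ m²`, BLMW 2011 (5.2.2)).
Ikenmeyer–Panova 2017 §1 (`q^m_λ(d[n])` versus the det side). [cite: IkenmeyerPanova2017, Thm. 1.3] -/
def PerDetMultiplicityObstructionAt (n m d : ℕ) [NeZero m] (lam : Nat.Partition (m * d)) : Prop :=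
  lam.parts.card ≤ m * m ∧
    PerDetMultiplicityObstruction (k := k) n m (Weight.dualOfPartition (m * m) lam).toMatIdx

/-- **Kronecker form** of an obstruction at `(n, m, d, λ)`: `n ≤ m`, `ℓ(λ) ≤ m²`, and the rectangular
Kronecker coefficient `g(λ, m×d, m×d)` — BLMW's upper bound for `mult_{λ^*} k[Δ(det_m)]`
(Prop. 5.2.1: orbit multiplicity = symmetric Kronecker coefficient `≤ g`) — is strictly smaller than
`mult_{λ^*} k[Δ(X₀₀^{m-n} per_n)]`. Ikenmeyer–Panova 2017, Thm. 1.3 of the e-print ("If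
`q^m_λ(d[n]) > g(λ, n×d, n×d)`, then `dc(per_m) > n`", their `n` = det size). [cite: IkenmeyerPanova2017, Thm. 1.3] -/
def PerDetKroneckerObstructionAt (n m d : ℕ) [NeZero m] (lam : Nat.Partition (m * d)) : Prop :=
  n ≤ m ∧ lam.parts.card ≤ m * m ∧
    kroneckerCoeff k lam (Nat.Partition.rectangle m d) (Nat.Partition.rectangle m d) <
      orbitMultiplicity k (paddedPerFormLex k n m) m (Weight.dualOfPartition (m * m) lam).toMatIdx

/-- Unfolding lemma: the weight form is the strict inequality of orbit-closure multiplicities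
together with `n ≤ m`. [folklore] -/
theorem perDetMultiplicityObstruction_iff {n m : ℕ} [NeZero m] {χ : Weight (MatIdx m)} :
    PerDetMultiplicityObstruction (k := k) n m χ ↔
      n ≤ m ∧ orbitMultiplicity k (detFormLex k m) m χ <
        orbitMultiplicity k (paddedPerFormLex k n m) m χ :=
  Iff.rfl

/-! ### Kronecker form ⇒ multiplicity form (BLMW Prop. 5.2.1, discharged in tree) -/

/-- A Kronecker-form obstruction is a multiplicity obstruction: in characteristic zero
`mult_{λ^*} k[Δ(det_m)] ≤ g(λ, m×d, m×d)` (BLMW 2011 Prop. 5.2.1 with (5.2.2)–(5.2.5);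
Bürgisser–Ikenmeyer STOC 2011 Thm. 4.3; tree: `orbitMultiplicity_det_le_kroneckerCoeff_holds`).
[cite: BLMW2011, Prop. 5.2.1] -/
theorem PerDetKroneckerObstructionAt.perDetMultiplicityObstructionAt [CharZero k] {n m d : ℕ}
    [NeZero m] {lam : Nat.Partition (m * d)} (h : PerDetKroneckerObstructionAt (k := k) n m d lam) :
    PerDetMultiplicityObstructionAt (k := k) n m d lam := by
  obtain ⟨hnm, hlam, hlt⟩ := h
  refine ⟨hlam, hnm, ?_⟩
  exact lt_of_le_of_lt (orbitMultiplicity_det_le_kroneckerCoeff_holds (k := k) lam hlam) hlt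

/-- The partition form yields the weight form at `χ = λ^*`. [folklore] -/
theorem PerDetMultiplicityObstructionAt.perDetMultiplicityObstruction {n m d : ℕ} [NeZero m]
    {lam : Nat.Partition (m * d)} (h : PerDetMultiplicityObstructionAt (k := k) n m d lam) :
    PerDetMultiplicityObstruction (k := k) n m (Weight.dualOfPartition (m * m) lam).toMatIdx :=
  h.2

/-! ### Obstruction ⇒ non-membership ⇒ `dc(per_n) > m` -/

/-- **Multiplicity-obstruction principle** for the pair (det, padded per): in characteristic zero a
`PerDetMultiplicityObstruction n m χ` proves `X₀₀^{m-n} per_n ∉ Δ(det_m)`, i.e.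
`¬ HasBorderDetRepr k n m`. One line over `not_hasBorderDetRepr_of_orbitMultiplicity_lt` and the
discharged facts `orbitMultiplicity_le_of_mem_orbitClosure_holds`, `hasBorderDetRepr_iff_rename_holds`.
Mulmuley–Sohoni 2008 §1–3; BLMW 2011 §1; BIP 2019 §1.1; Bläser–Ikenmeyer 2025 §12.4.
[cite: BlaeserIkenmeyer2025, §12.4] -/
theorem not_hasBorderDetRepr_of_perDetMultiplicityObstruction [CharZero k] {n m : ℕ} [NeZero m]
    {χ : Weight (MatIdx m)} (h : PerDetMultiplicityObstruction (k := k) n m χ) :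
    ¬ HasBorderDetRepr k n m :=
  not_hasBorderDetRepr_of_orbitMultiplicity_lt orbitMultiplicity_le_of_mem_orbitClosure_holds
    hasBorderDetRepr_iff_rename_holds h.1 h.2

/-- **Mulmuley–Sohoni 2001, Prop. 4.4, contrapositive.** Over an infinite field, if the padded
permanent `X₀₀^{m-n} per_n` (`n ≤ m`) is not in `Δ(det_m)`, then `dc(per_n) > m`: otherwise the
attained affine determinantal representation of `per_n` of size `dc(per_n)`
(`hasDetRepr_determinantalComplexity_holds`), padded to size `m` (`HasDetRepr.mono_holds`), would put
`X₀₀^{m-n} per_n` into `Δ(det_m)` (`paddedPerPoly_mem_orbitClosure_detPoly_of_hasDetRepr_holds`).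
BIP 2019 §1 ("`dc(per_m) ≤ n` implies `X₁₁^{n-m} per_m ∈ Ω_n`"). [cite: MulmuleySohoniSIAM2001, Prop. 4.4] -/
theorem lt_determinantalComplexity_perPoly_of_not_hasBorderDetRepr [Infinite k] {n m : ℕ}
    [NeZero m] (hnm : n ≤ m) (h : ¬ HasBorderDetRepr k n m) :
    m < determinantalComplexity (perPoly (Fin n) k) := by
  by_contra hle
  rw [not_lt] at hle
  exact h (paddedPerPoly_mem_orbitClosure_detPoly_of_hasDetRepr_holds
    (HasDetRepr.mono_holds (hasDetRepr_determinantalComplexity_holds (perPoly (Fin n) k)) hle) hnm)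

/-- **A multiplicity obstruction at `(n, m)` proves `dc(per_n) > m`** (weight form, characteristic
zero). Ikenmeyer–Panova 2017 Thm. 1.3 (e-print); BLMW 2011 §5.7; BIP 2019 §1.1 ("Its existence thus
proves that `Z_{n,m} ⊄ Ω_n` and hence `dc(per_m) > n`"). [cite: IkenmeyerPanova2017, Thm. 1.3] -/
theorem lt_determinantalComplexity_perPoly_of_perDetMultiplicityObstruction [CharZero k] {n m : ℕ}
    [NeZero m] {χ : Weight (MatIdx m)} (h : PerDetMultiplicityObstruction (k := k) n m χ) :
    m < determinantalComplexity (perPoly (Fin n) k) := by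
  haveI : Infinite k := CharZero.infinite k
  exact lt_determinantalComplexity_perPoly_of_not_hasBorderDetRepr h.1
    (not_hasBorderDetRepr_of_perDetMultiplicityObstruction h)

/-- **Certificate form**: an obstruction in coordinates `(n, m, d, λ)` proves `dc(per_n) > m`.
Ikenmeyer–Panova 2017 Thm. 1.3 (e-print). [cite: IkenmeyerPanova2017, Thm. 1.3] -/
theorem lt_determinantalComplexity_perPoly_of_perDetMultiplicityObstructionAt [CharZero k]
    {n m d : ℕ} [NeZero m] {lam : Nat.Partition (m * d)}
    (h : PerDetMultiplicityObstructionAt (k := k) n m d lam) :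
    m < determinantalComplexity (perPoly (Fin n) k) :=
  lt_determinantalComplexity_perPoly_of_perDetMultiplicityObstruction h.perDetMultiplicityObstruction

/-- **Kronecker form**: `g(λ, m×d, m×d) < mult_{λ^*} k[Δ(X₀₀^{m-n} per_n)]` with `ℓ(λ) ≤ m²`,
`n ≤ m`, proves `dc(per_n) > m` — verbatim the shape of Ikenmeyer–Panova 2017, Thm. 1.3 of the
e-print: "If `q^m_λ(d[n]) > g(λ, n×d, n×d)`, then `dc(per_m) > n`" (their `q` = multiplicity in the
coordinate ring of the padded permanent's orbit closure, their `n` = determinant size).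
[cite: IkenmeyerPanova2017, Thm. 1.3] -/
theorem lt_determinantalComplexity_perPoly_of_perDetKroneckerObstructionAt [CharZero k]
    {n m d : ℕ} [NeZero m] {lam : Nat.Partition (m * d)}
    (h : PerDetKroneckerObstructionAt (k := k) n m d lam) :
    m < determinantalComplexity (perPoly (Fin n) k) :=
  lt_determinantalComplexity_perPoly_of_perDetMultiplicityObstructionAt h.perDetMultiplicityObstructionAt

/-- Over `ℂ` (the cell's field), stated once in closed form for the engine's Lean checker: if some
highest weight `χ` of `GL_{m²}` flips the multiplicities at `(n, m)`, then `m < dc_ℂ(per_n)`.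
[cite: IkenmeyerPanova2017, Thm. 1.3] -/
theorem lt_determinantalComplexity_perPoly_complex_of_exists_obstruction {n m : ℕ} [NeZero m]
    (h : ∃ χ : Weight (MatIdx m), PerDetMultiplicityObstruction (k := ℂ) n m χ) :
    m < determinantalComplexity (perPoly (Fin n) ℂ) := by
  obtain ⟨χ, hχ⟩ := h
  exact lt_determinantalComplexity_perPoly_of_perDetMultiplicityObstruction hχ

/-! ### The symmetric Kronecker form (BLMW Prop. 5.2.1 (5.2.7), proved in tree) -/

/-- **Symmetric Kronecker form** of an obstruction at `(n, m, d, λ)`: `n ≤ m`, `ℓ(λ) ≤ m²`, and the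
rectangular SYMMETRIC Kronecker coefficient `sk(λ, m×d)` — the multiplicity of `λ^*` in the
coordinate ring of the ORBIT `GL_{m²}·det_m` (BLMW 2011 Prop. 5.2.1 (5.2.6)), hence an upper bound
for `mult_{λ^*} k[Δ(det_m)]` ((5.2.7); tree: `symKroneckerCoeffRect`,
`orbitMultiplicity_det_le_symKroneckerCoeffRect`, with the character formula
`two_mul_factorial_mul_symKroneckerCoeffRect`) — is strictly smaller than
`mult_{λ^*} k[Δ(X₀₀^{m-n} per_n)]`. The sharper of the two published det-side proxies (`sk ≤ g`,
`symKroneckerCoeffRect_le_kroneckerCoeff`); it is the det-side test "`pl_λ(d[n]) > sk(n×d; λ)`" of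
Bürgisser–Ikenmeyer STOC 2013 (5.2) and Ikenmeyer 2012 (8.1.1) (their `n` = determinant size, with
the generic/padded form on the other side). [cite: BLMW2011, §5.2 Prop. 5.2.1] -/
def PerDetSymKroneckerObstructionAt (n m d : ℕ) [NeZero m] (lam : Nat.Partition (m * d)) : Prop :=
  n ≤ m ∧ lam.parts.card ≤ m * m ∧
    symKroneckerCoeffRect k m d lam <
      orbitMultiplicity k (paddedPerFormLex k n m) m (Weight.dualOfPartition (m * m) lam).toMatIdx

/-- A symmetric-Kronecker-form obstruction is a multiplicity obstruction: in characteristic zero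
`mult_{λ^*} k[Δ(det_m)] ≤ sk(λ, m×d)` (BLMW 2011 Prop. 5.2.1 (5.2.7); tree:
`orbitMultiplicity_det_le_symKroneckerCoeffRect`). [cite: BLMW2011, §5.2 Prop. 5.2.1] -/
theorem PerDetSymKroneckerObstructionAt.perDetMultiplicityObstructionAt [CharZero k] {n m d : ℕ}
    [NeZero m] {lam : Nat.Partition (m * d)} (h : PerDetSymKroneckerObstructionAt (k := k) n m d lam) :
    PerDetMultiplicityObstructionAt (k := k) n m d lam := by
  obtain ⟨hnm, hlam, hlt⟩ := h
  refine ⟨hlam, hnm, ?_⟩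
  exact lt_of_le_of_lt (orbitMultiplicity_det_le_symKroneckerCoeffRect k m lam hlam) hlt

/-- A Kronecker-form obstruction is a symmetric-Kronecker-form obstruction (`sk ≤ g`, BLMW 2011
(5.2.5); tree: `symKroneckerCoeffRect_le_kroneckerCoeff`) — the symmetric form is the weaker
hypothesis, i.e. the stronger test. [cite: BLMW2011, §5.2 (5.2.5)] -/
theorem PerDetKroneckerObstructionAt.perDetSymKroneckerObstructionAt [CharZero k] {n m d : ℕ}
    [NeZero m] {lam : Nat.Partition (m * d)} (h : PerDetKroneckerObstructionAt (k := k) n m d lam) :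
    PerDetSymKroneckerObstructionAt (k := k) n m d lam := by
  obtain ⟨hnm, hlam, hlt⟩ := h
  exact ⟨hnm, hlam, lt_of_le_of_lt (symKroneckerCoeffRect_le_kroneckerCoeff k lam hlam) hlt⟩

/-- **Symmetric Kronecker form**: `sk(λ, m×d) < mult_{λ^*} k[Δ(X₀₀^{m-n} per_n)]` with `ℓ(λ) ≤ m²`,
`n ≤ m`, proves `dc(per_n) > m` (characteristic zero). Bürgisser–Ikenmeyer STOC 2013 §5 ("Note that
an explicit construction and evaluation of the HWVs in `Sym^d Sym^n ℂ^ℓ` would directly give lower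
bounds on dc for specific `f`"); Ikenmeyer–Panova 2017 Thm. 1.3 (e-print) with `g` sharpened to `sk`.
[cite: IkenmeyerPanova2017, Thm. 1.3] -/
theorem lt_determinantalComplexity_perPoly_of_perDetSymKroneckerObstructionAt [CharZero k]
    {n m d : ℕ} [NeZero m] {lam : Nat.Partition (m * d)}
    (h : PerDetSymKroneckerObstructionAt (k := k) n m d lam) :
    m < determinantalComplexity (perPoly (Fin n) k) :=
  lt_determinantalComplexity_perPoly_of_perDetMultiplicityObstructionAt h.perDetMultiplicityObstructionAt

/-- **Certificate assembly** (characteristic zero): from `n ≤ m`, `ℓ(λ) ≤ m²`, a natural number `s`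
with `∑_{τ ∈ 𝔖_{md}} χ^λ(τ) (χ^□(τ)² + χ^□(τ²)) = 2·(md)!·s` (so that `s = sk(λ, m×d)` by
`two_mul_factorial_mul_symKroneckerCoeffRect`; over `ℂ` the sum is computed by the tree's
`MNEval.skSumT`, `sum_symSq_eq_skSumT`) and a lower bound `s < r ≤ mult_{λ^*} k[Δ(X₀₀^{m-n} per_n)]`
on the permanent side, the symmetric Kronecker form holds. This is the shape of an engine
certificate `(n, m, d, λ; s; r)`. [cite: BLMW2011, §5.2 Prop. 5.2.1] -/
theorem PerDetSymKroneckerObstructionAt.of_sum_eq [CharZero k] {n m d : ℕ} [NeZero m]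
    {lam : Nat.Partition (m * d)} (hnm : n ≤ m) (hlam : lam.parts.card ≤ m * m) {s r : ℕ}
    (hsum : ∑ τ : Equiv.Perm (Fin (m * d)), spechtCharacter k lam τ *
        (spechtCharacter k (Nat.Partition.rectangle m d) τ ^ 2 +
          spechtCharacter k (Nat.Partition.rectangle m d) (τ * τ)) =
      ((2 * (m * d).factorial * s : ℕ) : k))
    (hsr : s < r)
    (hr : r ≤ orbitMultiplicity k (paddedPerFormLex k n m) m (Weight.dualOfPartition (m * m) lam).toMatIdx) :
    PerDetSymKroneckerObstructionAt (k := k) n m d lam := by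
  refine ⟨hnm, hlam, lt_of_lt_of_le ?_ hr⟩
  have h := two_mul_factorial_mul_symKroneckerCoeffRect k lam hlam
  rw [hsum] at h
  have h' : 2 * (m * d).factorial * symKroneckerCoeffRect k m d lam = 2 * (m * d).factorial * s :=
    Nat.cast_injective h
  have hpos : 0 < 2 * (m * d).factorial := Nat.mul_pos two_pos (Nat.factorial_pos _)
  rw [Nat.eq_of_mul_eq_mul_left hpos h']
  exact hsr

end Literature.Computability.AlgebraicComplexity
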